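import Literature.AlgebraicGeometry.HodgeTheory.DominantPieceOverCurveDimension
import Literature.AlgebraicGeometry.HodgeTheory.GenericFibreClosedSubsetSpread
import Literature.AlgebraicGeometry.HodgeTheory.GysinFormalismPushforward
import HarnessLib

/-!
# Propagation of supports from a dominant parameter curve to every fibre of a family over a curve

Topic `Literature/AlgebraicGeometry/HodgeTheory` (family `hodge`). Theorems only (no definition, no
named fact, no `sorry`). Sequel of `AlgebraicityLocusCurves` (limits of supported classes along a
smooth curve: Charles–Schnell 2014, proof of Prop. 11.3.11, step 3; Voisin, *Hodge Theory II*,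
§3.3.1) and `DominantPieceOverCurveDimension`, removing the last projectivity assumption on the
TOTAL SPACE from the spreading argument for the variational Hodge conjecture over a curve.

Setting: `f : 𝒳 ⟶ S` a smooth projective family (`Motives.IsSmoothProjectiveFamily`: smooth of
relative dimension `n`, proper, with smooth projective fibres — the total space `𝒳` need NOT be
quasi-projective) over a smooth integral quasi-compact quasi-projective CURVE `S`; a smooth integral
quasi-compact curve `C` with a DOMINANT morphism `φ : C ⟶ S` (in the application: the normalisation
of a curve in a parameter space of cycles, Mumford's curve lemma); a cartesian square
`(q, g; f, φ)` (`𝒲 = 𝒳 ×_S C`, the pulled-back family `g : 𝒲 ⟶ C`); a Zariski-closed `Z ⊆ 𝒲`, i.e.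
a family of supports in the fibres `𝒳_{φ(c)} ≅ 𝒲_c`; and a global class `A ∈ H²ᵖ(𝒳(ℂ); ℂ)`.

* `mem_algebraicClasses_of_dominant_curve` — **if `(q^* A)|_{𝒲_c}` dies off the slice `Z_c` for
  the complex points `c` of a non-empty open `U ⊆ C`, and the slice over ONE complex point `a ∈ C(ℂ)`
  has codimension `≥ p` (every point `z` of it has `height z + p ≤ n`), then `A|_{𝒳_u}` is
  algebraic (supported in codimension `p`; `algebraicClasses = Nᵖ H²ᵖ`) at EVERY complex point `u`
  of `S`** — including the finitely many points of `S` missed by `φ`. The printed argument ("the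
  cycles `Z_c` sweep out a cycle on `𝒳` whose restriction to every fibre is a limit of the `Z_c`,
  of the same codimension", Voisin II §3.3.1; Charles–Schnell, proof of Prop. 11.3.11) is run in
  the tree's support language WITHOUT Hilbert schemes or an embedding `𝒳 ↪ ℙᴺ`: decompose the
  closed image `𝒵 ⊆ 𝒳 × C` of `Z` under the proper `(q, g)` into finitely many irreducible closed
  pieces (`𝒳 × C` is Noetherian); discard from `U` the closures of the images of the pieces NOT
  dominating `C` (finitely many proper closed subsets of the irreducible curve `C`); a dominating
  piece has generic point `ξ_V` over the generic point of `C` with `height ξ_V + p ≤ n + 1`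
  (`height_genericPoint_add_le_of_dense_piece`: flatness over the smooth curve and the dimension of
  the fibre over `a`). Push everything into `𝒳 × S` along `𝒳 × φ` and close up: the closure `𝒵_S`
  is contained in the union of the closures of the points `(𝒳 × φ)(ξ_V)`, points of height
  `≤ (n - p) + 1` over the generic point of `S` (`φ` is dominant); a point of `𝒵_S` over a COMPLEX
  point of `S` is a proper specialisation of one of them, hence of height `≤ n - p`. So every slice
  of `𝒵_S` over a complex point has codimension `≥ p`, and over the open image `φ(U') ⊆ S` (`φ` is
  flat, hence open) the class dies off the slices (they contain the images of the `Z_c`, and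
  `𝒲_c ≅ 𝒳_{φ(c)}` compatibly with `q`); the tree's `mem_algebraicClasses_of_curve` — strong upper
  semicontinuity of supports and SGA1 XII 2.2, applied to the family `f` itself with parameter curve
  `S` — concludes at every complex point of `S`.

## References

* [VoisinHodgeII2003] C. Voisin, Hodge Theory and Complex Algebraic Geometry II (2003), §3.3.1.
* [CharlesSchnell2014Notes] F. Charles, C. Schnell, Notes on absolute Hodge classes (2014),
  Prop. 11.3.11 (proof).
* [Fulton1998] W. Fulton, Intersection Theory (1998), §10.1.
* [Hartshorne1977] R. Hartshorne, Algebraic Geometry (1977), III Prop. 9.7 and Ex. 9.1,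
  II Ex. 3.22, I Ex. 1.6.
-/

noncomputable section

open CategoryTheory AlgebraicGeometry Limits Set Order MonoidalCategory CartesianMonoidalCategory
open _root_.Topology TopologicalSpace
open Literature.AlgebraicGeometry.Motives

namespace Literature.AlgebraicGeometry.HodgeTheory

section HodgeTheory

/-! ### Two topological helpers -/

/-- In an irreducible space, removing finitely many closed subsets different from the whole space
from a non-empty open set leaves a non-empty set. [folklore] -/
private theorem nonempty_diff_biUnion_of_irreducibleSpace {α : Type*} [TopologicalSpace α]
    [IrreducibleSpace α] {U : Set α} (hUo : IsOpen U) (hU : U.Nonempty) {ι : Type*} {I : Set ι}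
    (hI : I.Finite) (F : ι → Set α) (hFcl : ∀ i ∈ I, IsClosed (F i))
    (hFne : ∀ i ∈ I, F i ≠ Set.univ) : (U \ ⋃ i ∈ I, F i).Nonempty := by
  induction I, hI using Set.Finite.induction_on with
  | empty => simpa using hU
  | @insert i I hiI hIfin ih =>
    have hcl : ∀ j ∈ I, IsClosed (F j) := fun j hj => hFcl j (Set.mem_insert_of_mem _ hj)
    have hne : ∀ j ∈ I, F j ≠ Set.univ := fun j hj => hFne j (Set.mem_insert_of_mem _ hj)
    have h1 : (U \ ⋃ j ∈ I, F j).Nonempty := ih hcl hne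
    have ho1 : IsOpen (U \ ⋃ j ∈ I, F j) :=
      hUo.sdiff (hIfin.isClosed_biUnion fun j hj => hcl j hj)
    have ho2 : IsOpen (F i)ᶜ := (hFcl i (Set.mem_insert _ _)).isOpen_compl
    have h2 : ((F i)ᶜ).Nonempty := by
      rw [Set.nonempty_compl]
      exact hFne i (Set.mem_insert _ _)
    obtain ⟨x, hx1, hx2⟩ := nonempty_preirreducible_inter ho1 ho2 h1 h2
    refine ⟨x, hx1.1, ?_⟩
    rw [Set.biUnion_insert]
    exact fun hx => hx.elim hx2 hx1.2

/-- Slices commute with base change of the parameter scheme, on points: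
`(X × γ)(i_y x) = i_{γ(y)} x` (a copy of `whiskerLeft_sliceAt_base_apply` of
`AlgebraicityLocusBoundary`, whose imports are unrelated). [folklore] -/
private theorem whiskerLeft_sliceAt_base_apply' {X H H' : Motives.SchemeOver ℂ} (γ : H' ⟶ H)
    (y : Motives.ComplexPoints H') (x : X.left) :
    (X ◁ γ).left.base ((sliceAt X y).left.base x) =
      (sliceAt X (AlgPoints.map γ y)).left.base x := by
  have h : sliceAt X y ≫ X ◁ γ = sliceAt X (AlgPoints.map γ y) := by
    simp only [sliceAt, CartesianMonoidalCategory.lift_whiskerLeft, Category.assoc,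
      AlgPoints.map_apply]
  rw [← h]
  rfl

/-- **A point of `𝒳 × T` over a complex point `y` of `T` is the slice of its first projection**:
if `pr_T w = pt y` then `w = i_y (pr_𝒳 w)` (the slice `i_y` is the base change of the rational
point `y : Spec ℂ → T`, whose image is `pr_T⁻¹(pt y)`, and `pr_𝒳 ∘ i_y = id`). [folklore] -/
private theorem eq_sliceAt_of_snd_eq {𝒳 T : Motives.SchemeOver ℂ} (y : Motives.ComplexPoints T)
    (w : (𝒳 ⊗ T).left) (hw : (CartesianMonoidalCategory.snd 𝒳 T).left.base w = y.pt) :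
    w = (sliceAt 𝒳 y).left.base ((CartesianMonoidalCategory.fst 𝒳 T).left.base w) := by
  obtain ⟨x, rfl⟩ := exists_sliceAt_base_eq y w hw
  have h : (sliceAt 𝒳 y ≫ CartesianMonoidalCategory.fst 𝒳 T).left.base x = x := by
    rw [sliceAt_fst]; rfl
  rw [Over.comp_left, Scheme.Hom.comp_base, TopCat.coe_comp, Function.comp_apply] at h
  rw [h]

/-! ### The main theorem -/

section Main

variable {𝒳 S C 𝒲 : Motives.SchemeOver ℂ} (f : 𝒳 ⟶ S) (φ : C ⟶ S) (q : 𝒲 ⟶ 𝒳) (g : 𝒲 ⟶ C)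

/-- **Propagation of supports from a dominant parameter curve to EVERY fibre of a family over a
curve** (the spreading step of the variational Hodge conjecture over a curve, for smooth PROPER
families with projective fibres — no projectivity of the total space). Let `f : 𝒳 ⟶ S` be a
smooth projective family of relative dimension `n` over a smooth integral quasi-compact
quasi-projective curve `S`, `φ : C ⟶ S` a dominant morphism from a smooth integral quasi-compact
curve, `(q, g; f, φ)` a cartesian square (`𝒲 = 𝒳 ×_S C`), `Z ⊆ 𝒲` Zariski-closed,
`A ∈ H²ᵖ(𝒳(ℂ); ℂ)`, `U ⊆ C` a non-empty open such that for every complex point `c` over `U` the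
class `(q^* A)|_{𝒲_c}` dies off the slice `ι_c⁻¹ Z`, and `a ∈ C(ℂ)` a complex point whose slice
consists of points `z` with `height z + p ≤ n` (codimension `≥ p` in the `n`-dimensional fibre).
Then `A|_{𝒳_u} ∈ algebraicClasses (𝒳_u) p` for EVERY complex point `u` of `S`. See the module
docstring for the proof (finite decomposition of the image of `Z` in `𝒳 × C`, the dimension of the
dominating pieces, push-forward to `𝒳 × S` and closure, dimensions of closures of points under
specialisation, and the tree's `mem_algebraicClasses_of_curve` over the parameter curve `S`
itself). [cite: VoisinHodgeII2003, §3.3.1] [cite: CharlesSchnell2014Notes, Prop. 11.3.11 (proof)]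
[cite: Fulton1998, §10.1] -/
theorem mem_algebraicClasses_of_dominant_curve {n : ℕ}
    (hfam : Motives.IsSmoothProjectiveFamily f n) (hS : IsQuasiProjectiveOver S)
    [IsIntegral S.left] [SmoothOfRelativeDimension 1 S.hom] [CompactSpace S.left]
    [IsIntegral C.left] [SmoothOfRelativeDimension 1 C.hom] [CompactSpace C.left]
    [IsDominant φ.left] (H : IsPullback q g f φ) (p : ℕ) (A : complexBetti 𝒳 (2 * p))
    {Z : Set 𝒲.left} (hZ : IsClosed Z) {U : Set C.left} (hUo : IsOpen U) (hU : U.Nonempty)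
    (hdeath : ∀ c : Motives.ComplexPoints C, c.pt ∈ U →
      complexBetti.restrictCompl (Motives.fiberOver g c) ((Motives.fiberι g c).left.base ⁻¹' Z)
        (2 * p) (complexBetti.map (Motives.fiberι g c) (2 * p) (complexBetti.map q (2 * p) A)) = 0)
    (a : Motives.ComplexPoints C)
    (ha : ∀ z : (Motives.fiberOver g a).left,
      (Motives.fiberι g a).left.base z ∈ Z → height z + p ≤ (n : ℕ∞))
    (u : Motives.ComplexPoints S) :
    complexBetti.map (Motives.fiberι f u) (2 * p) A ∈ algebraicClasses (Motives.fiberOver f u) p := by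
  classical
  -- ### standing instances
  haveI : Smooth S.hom := SmoothOfRelativeDimension.smooth 1 S.hom
  haveI : Smooth C.hom := SmoothOfRelativeDimension.smooth 1 C.hom
  haveI : LocallyOfFiniteType S.hom := inferInstance
  haveI : LocallyOfFiniteType C.hom := inferInstance
  haveI : IsSeparated S.hom := hS.isVarietyPair_ofScheme.isSeparated
  obtain ⟨h𝒳ft, h𝒳qc⟩ := locallyOfFiniteType_and_quasiCompact_hom f hfam hS
  haveI := h𝒳ft
  haveI := h𝒳qc
  haveI : IsProper f.left := hfam.isProper
  haveI : IsSeparated 𝒳.hom := by rw [← Over.w f]; infer_instance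
  haveI : IsNoetherian (𝒳 ⊗ C).left := isNoetherian_tensorObj_left
  haveI : LocallyOfFiniteType (𝒳 ⊗ C).hom :=
    inferInstanceAs (LocallyOfFiniteType (pullback.fst 𝒳.hom C.hom ≫ 𝒳.hom))
  haveI : LocallyOfFiniteType (𝒳 ⊗ S).hom :=
    inferInstanceAs (LocallyOfFiniteType (pullback.fst 𝒳.hom S.hom ≫ 𝒳.hom))
  haveI : LocallyOfFiniteType φ.left := by
    have h : LocallyOfFiniteType (φ.left ≫ S.hom) := by rw [Over.w φ]; infer_instance
    exact locallyOfFiniteType_of_comp φ.left S.hom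
  haveI : IsLocallyNoetherian S.left := LocallyOfFiniteType.isLocallyNoetherian S.hom
  haveI : LocallyOfFinitePresentation φ.left :=
    locallyOfFinitePresentation_of_isLocallyNoetherian φ.left
  haveI : Flat φ.left := flat_of_isDominant_of_smoothCurve S φ.left
  have H' : IsPullback q.left g.left f.left φ.left := H.map (Over.forget _)
  haveI : IsProper g.left := MorphismProperty.of_isPullback (P := @IsProper) H' inferInstance
  haveI : LocallyOfFiniteType 𝒲.hom := by rw [← Over.w g]; infer_instance
  -- ### the proper map `m = (q, g) : 𝒲 ⟶ 𝒳 × C` and the closed family of supports `𝒵 = m(Z)`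
  set m : 𝒲 ⟶ 𝒳 ⊗ C := CartesianMonoidalCategory.lift q g with hmdef
  have hm_snd : m ≫ CartesianMonoidalCategory.snd 𝒳 C = g := lift_snd q g
  have hmsnd : ∀ z, (CartesianMonoidalCategory.snd 𝒳 C).left.base (m.left.base z) = g.left.base z :=
    fun z => by
    change (m ≫ CartesianMonoidalCategory.snd 𝒳 C).left.base z = _
    rw [hm_snd]
  have hmfst : ∀ z, (CartesianMonoidalCategory.fst 𝒳 C).left.base (m.left.base z) = q.left.base z :=
    fun z => by
    change (m ≫ CartesianMonoidalCategory.fst 𝒳 C).left.base z = _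
    rw [hmdef, lift_fst]
  haveI : IsSeparated (CartesianMonoidalCategory.snd 𝒳 C).left :=
    inferInstanceAs (IsSeparated (pullback.snd 𝒳.hom C.hom))
  haveI : IsProper (m.left ≫ (CartesianMonoidalCategory.snd 𝒳 C).left) := by
    rw [← Over.comp_left, hm_snd]
    infer_instance
  haveI : IsProper m.left := IsProper.of_comp m.left (CartesianMonoidalCategory.snd 𝒳 C).left
  set 𝒵 : Set (𝒳 ⊗ C).left := m.left.base '' Z with h𝒵def
  have h𝒵c : IsClosed 𝒵 := m.left.isClosedMap _ hZ
  -- points of the fibre `𝒲_c` over a complex point `c` of `C` lie over `pt c`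
  have hgfib : ∀ (c : Motives.ComplexPoints C) (z : (Motives.fiberOver g c).left),
      g.left.base ((Motives.fiberι g c).left.base z) = c.pt := fun c z => by
    have h := congrArg (fun ψ => ψ.left.base z) (Motives.fiberι_comp g c)
    simp only [Over.comp_left, Scheme.Hom.comp_base, TopCat.coe_comp, Function.comp_apply] at h
    rw [h]
    change c.left.base _ = c.left.base (IsLocalRing.closedPoint ℂ)
    exact congrArg c.left.base (Subsingleton.elim (α := PrimeSpectrum ℂ) _ _)
  -- ### finite decomposition of `𝒵` into irreducible closed pieces; the dominating ones
  obtain ⟨𝔖, h𝔖fin, h𝔖cl, h𝔖irr, h𝒵eq⟩ :=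
    NoetherianSpace.exists_finite_set_isClosed_irreducible h𝒵c
  let Dom : Set (𝒳 ⊗ C).left → Prop := fun V =>
    closure ((CartesianMonoidalCategory.snd 𝒳 C).left.base '' V) = Set.univ
  -- the shrunken open `U' ⊆ U`: remove the closures of the images of the non-dominating pieces
  set U' : Set C.left :=
    U \ ⋃ V ∈ {V ∈ 𝔖 | ¬ Dom V}, closure ((CartesianMonoidalCategory.snd 𝒳 C).left.base '' V)
    with hU'def
  have hND : ({V ∈ 𝔖 | ¬ Dom V}).Finite := h𝔖fin.subset (Set.sep_subset _ _)
  have hU'o : IsOpen U' :=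
    hUo.sdiff (hND.isClosed_biUnion fun V _ => isClosed_closure)
  have hU'U : U' ⊆ U := fun c hc => hc.1
  have hU'ne : U'.Nonempty :=
    nonempty_diff_biUnion_of_irreducibleSpace hUo hU hND
      (fun V => closure ((CartesianMonoidalCategory.snd 𝒳 C).left.base '' V))
      (fun V _ => isClosed_closure) (fun V hV => hV.2)
  -- a point of `𝒵` over `U'` lies in a dominating piece
  have hdomOf : ∀ w ∈ 𝒵, (CartesianMonoidalCategory.snd 𝒳 C).left.base w ∈ U' →
      ∃ V ∈ 𝔖, Dom V ∧ w ∈ V := by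
    intro w hw hwU'
    have hw' : w ∈ ⋃₀ 𝔖 := h𝒵eq ▸ hw
    obtain ⟨V, hV𝔖, hwV⟩ := Set.mem_sUnion.1 hw'
    refine ⟨V, hV𝔖, ?_, hwV⟩
    by_contra hnd
    apply hwU'.2
    refine Set.mem_biUnion (x := V) ⟨hV𝔖, hnd⟩ ?_
    exact subset_closure ⟨w, hwV, rfl⟩
  -- the dominating pieces, their generic points, and the dimension bound
  let 𝔇 : Type := {V : Set (𝒳 ⊗ C).left // V ∈ 𝔖 ∧ Dom V}
  haveI : Finite 𝔇 := (h𝔖fin.subset (fun V (hV : V ∈ 𝔖 ∧ Dom V) => hV.1)).to_subtype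
  let ξ : 𝔇 → (𝒳 ⊗ C).left := fun d => (h𝔖irr d.1 d.2.1).genericPoint
  have hξgen : ∀ d : 𝔇, IsGenericPoint (ξ d) d.1 := fun d =>
    (h𝔖irr d.1 d.2.1).isGenericPoint_genericPoint (h𝔖cl d.1 d.2.1)
  have hξ : ∀ d : 𝔇, height (ξ d) + p ≤ ((n + 1 : ℕ) : ℕ∞) ∧
      (CartesianMonoidalCategory.snd 𝒳 C).left.base (ξ d) = genericPoint C.left := fun d =>
    height_genericPoint_add_le_of_dense_piece q g hZ a ha (h𝔖cl d.1 d.2.1) (h𝔖irr d.1 d.2.1)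
      (by rw [← hmdef, ← h𝒵def, h𝒵eq]; exact Set.subset_sUnion_of_mem d.2.1) d.2.2
  -- ### push forward to `𝒳 × S` along `𝒳 × φ` and close up
  set Φ : 𝒳 ⊗ C ⟶ 𝒳 ⊗ S := 𝒳 ◁ φ with hΦdef
  have hΦsnd : ∀ w, (CartesianMonoidalCategory.snd 𝒳 S).left.base (Φ.left.base w) =
      φ.left.base ((CartesianMonoidalCategory.snd 𝒳 C).left.base w) := fun w => by
    change (Φ ≫ CartesianMonoidalCategory.snd 𝒳 S).left.base w =
      (CartesianMonoidalCategory.snd 𝒳 C ≫ φ).left.base w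
    rw [hΦdef, whiskerLeft_snd]
  set 𝒵' : Set (𝒳 ⊗ C).left := 𝒵 ∩ (CartesianMonoidalCategory.snd 𝒳 C).left.base ⁻¹' U'
    with h𝒵'def
  set 𝒵S : Set (𝒳 ⊗ S).left := closure (Φ.left.base '' 𝒵') with h𝒵Sdef
  have h𝒵Sc : IsClosed 𝒵S := isClosed_closure
  -- `𝒵S` is covered by the closures of the points `Φ (ξ d)`
  have hcover : 𝒵S ⊆ ⋃ d : 𝔇, closure {Φ.left.base (ξ d)} := by
    refine closure_minimal ?_ (isClosed_iUnion_of_finite fun d => isClosed_closure)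
    rintro _ ⟨w, ⟨hw𝒵, hwU'⟩, rfl⟩
    obtain ⟨V, hV𝔖, hVdom, hwV⟩ := hdomOf w hw𝒵 hwU'
    refine Set.mem_iUnion.2 ⟨⟨V, hV𝔖, hVdom⟩, ?_⟩
    have hwcl : w ∈ closure {ξ ⟨V, hV𝔖, hVdom⟩} := by
      rw [(hξgen ⟨V, hV𝔖, hVdom⟩).def]; exact hwV
    exact ((specializes_iff_mem_closure.2 hwcl).map Φ.left.continuous).mem_closure
  -- ### (a) every slice of `𝒵S` over a complex point of `S` has codimension `≥ p`
  have hcodimS : ∀ (y : Motives.ComplexPoints S) (x : 𝒳.left),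
      (sliceAt 𝒳 y).left.base x ∈ 𝒵S → height x + p ≤ (n : ℕ∞) := by
    intro y x hx
    obtain ⟨d, hd⟩ := Set.mem_iUnion.1 (hcover hx)
    set w := (sliceAt 𝒳 y).left.base x with hwdef
    set ζ := Φ.left.base (ξ d) with hζdef
    -- `ζ` lies over the generic point of `S`, `w` over the closed point `pt y`: `w < ζ`
    have hζsnd : (CartesianMonoidalCategory.snd 𝒳 S).left.base ζ = genericPoint S.left := by
      rw [hζdef, hΦsnd, (hξ d).2]
      exact genericPoint_eq_of_isDominant' φ.left
    have hwsnd : (CartesianMonoidalCategory.snd 𝒳 S).left.base w = y.pt := snd_sliceAt_base y x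
    have hne : w ≠ ζ := by
      intro h
      have h1 := hwsnd
      rw [h, hζsnd] at h1
      exact AlgPoints.apply_ne_genericPoint y (IsLocalRing.closedPoint ℂ) h1.symm
    have hle : w ≤ ζ := Scheme.le_iff_specializes.2 (specializes_iff_mem_closure.2 hd)
    have hlt : w < ζ := lt_iff_le_not_ge.2 ⟨hle, fun h' =>
      hne ((Scheme.le_iff_specializes.1 h').antisymm (Scheme.le_iff_specializes.1 hle)).eq⟩
    -- heights
    have hζle : height ζ + p ≤ ((n + 1 : ℕ) : ℕ∞) :=
      (add_le_add (height_base_le_height_of_schemeOver Φ (ξ d)) le_rfl).trans (hξ d).1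
    have hζfin : height ζ < ⊤ :=
      lt_of_le_of_lt (le_self_add.trans hζle) (ENat.coe_lt_top _)
    have hwfin : height w < ⊤ := lt_of_le_of_lt (height_mono hle) hζfin
    have hwlt : height w < height ζ := height_strictMono hlt hwfin
    have hxw : height x = height w := (height_sliceAt_base_eq (𝒳 := 𝒳) y x).symm
    -- arithmetic in `ℕ∞`
    obtain ⟨kw, hkw⟩ := ENat.ne_top_iff_exists.1 hwfin.ne
    obtain ⟨kζ, hkζ⟩ := ENat.ne_top_iff_exists.1 hζfin.ne
    rw [hxw, ← hkw]
    rw [← hkw, ← hkζ] at hwlt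
    rw [← hkζ] at hζle
    have h1 : kw < kζ := by exact_mod_cast hwlt
    have h2 : kζ + p ≤ n + 1 := by exact_mod_cast hζle
    have h3 : kw + p ≤ n := by omega
    exact_mod_cast h3
  -- ### (b) over the open `φ(U')` the class dies off the slices of `𝒵S`
  have hUS : IsOpen (φ.left.base '' U') := φ.left.isOpenMap _ hU'o
  have hUSne : (φ.left.base '' U').Nonempty := hU'ne.image _
  have hgoodS : ∀ y : Motives.ComplexPoints S, y.pt ∈ φ.left.base '' U' →
      complexBetti.map (Motives.fiberι f y) (2 * p) A ∈
        LinearMap.ker (complexBetti.restrictCompl (Motives.fiberOver f y)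
          ((CartesianMonoidalCategory.lift (Motives.fiberι f y)
            (Motives.fiberOverToSpec f y ≫ y)).left.base ⁻¹' 𝒵S) (2 * p)).hom := by
    intro y hy
    obtain ⟨c₀, hc₀U', hc₀y⟩ := hy
    -- `c₀` is a closed point: the complex point `c` of `C` over it, with `φ(c) = y`
    have hc₀ne : c₀ ≠ (⊤ : C.left) := by
      intro h
      rw [h] at hc₀y
      have h1 : φ.left.base (genericPoint C.left) = genericPoint S.left :=
        genericPoint_eq_of_isDominant' φ.left
      exact AlgPoints.apply_ne_genericPoint y (IsLocalRing.closedPoint ℂ) (hc₀y.symm.trans h1)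
    have hc₀cl : IsClosed ({c₀} : Set C.left) := by
      refine closure_subset_iff_isClosed.1 fun c' hc' => ?_
      exact Set.mem_singleton_iff.2
        (eq_of_specializes_of_ne_top hc₀ne (specializes_iff_mem_closure.2 hc'))
    set c : Motives.ComplexPoints C :=
      (Motives.ComplexPoints.equivClosedPoints C).symm ⟨c₀, hc₀cl⟩ with hcdef
    have hcpt : c.pt = c₀ := by
      have h := Motives.ComplexPoints.coe_equivClosedPoints_apply C c
      rw [hcdef, Equiv.apply_symm_apply] at h
      exact h.symm
    have hyc : AlgPoints.map φ c = y := by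
      apply (Motives.ComplexPoints.equivClosedPoints S).injective
      apply Subtype.ext
      rw [Motives.ComplexPoints.coe_equivClosedPoints_apply,
        Motives.ComplexPoints.coe_equivClosedPoints_apply, AlgPoints.pt_map, hcpt, hc₀y]
    subst hyc
    -- the fibre identification `𝒲_c ≅ 𝒳_{φ(c)}` and the death of the pulled-back class
    obtain ⟨e, he⟩ := exists_fiberOver_iso_of_isPullback H c
    have he' : Motives.fiberι f (AlgPoints.map φ c) = e.inv ≫ Motives.fiberι g c ≫ q := by
      rw [← he, e.inv_hom_id_assoc]
    have hd := hdeath c (hU'U (hcpt ▸ hc₀U'))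
    have hd' := complexBetti.restrictCompl_map_eq_zero e.inv hd
    have hA : complexBetti.map e.inv (2 * p) (complexBetti.map (Motives.fiberι g c) (2 * p)
        (complexBetti.map q (2 * p) A)) =
        complexBetti.map (Motives.fiberι f (AlgPoints.map φ c)) (2 * p) A := by
      rw [he', complexBetti.map_comp, complexBetti.map_comp]
      rfl
    rw [hA] at hd'
    refine LinearMap.mem_ker.2 (complexBetti.restrictCompl_eq_zero_of_subset ?_ hd')
    -- the slice of `Z` over `c`, moved to `𝒳_{φ(c)}`, lies in the slice of `𝒵S`
    intro x hx
    have hx' : (Motives.fiberι g c).left.base (e.inv.left.base x) ∈ Z := hx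
    rw [Set.mem_preimage, lift_fiberι_base_apply]
    refine subset_closure ⟨m.left.base ((Motives.fiberι g c).left.base (e.inv.left.base x)),
      ⟨⟨_, hx', rfl⟩, ?_⟩, ?_⟩
    · rw [Set.mem_preimage, hmsnd, hgfib, hcpt]
      exact hc₀U'
    · have h1 : m.left.base ((Motives.fiberι g c).left.base (e.inv.left.base x)) =
          (sliceAt 𝒳 c).left.base (q.left.base ((Motives.fiberι g c).left.base
            (e.inv.left.base x))) := by
        have h := eq_sliceAt_of_snd_eq c (m.left.base ((Motives.fiberι g c).left.base
          (e.inv.left.base x))) (by rw [hmsnd, hgfib])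
        rwa [hmfst] at h
      have h2 : q.left.base ((Motives.fiberι g c).left.base (e.inv.left.base x)) =
          (Motives.fiberι f (AlgPoints.map φ c)).left.base x := by
        change (e.inv ≫ Motives.fiberι g c ≫ q).left.base x = _
        rw [← he']
      rw [h1, h2, whiskerLeft_sliceAt_base_apply']
  -- ### (c) the curve theorem over the parameter curve `S` itself
  have key := mem_algebraicClasses_of_curve f hfam hS (SmoothOfRelativeDimension.smooth 1 S.hom)
    (T := S) (𝟙 S) p A h𝒵Sc hUS hUSne (fun y _ x hx => hcodimS y x hx)
    (fun y hy => hgoodS (AlgPoints.map (𝟙 S) y) (by simpa only [AlgPoints.map_id_apply] using hy))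
    u
  rw [AlgPoints.map_id_apply] at key
  exact key

end Main

end HodgeTheory

end Literature.AlgebraicGeometry.HodgeTheory

end
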